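import Summits.ResolutionOfSingularities.ResolutionOfSingularities.Theorems.FrobeniusClosingSteerK7HatBranchConclusion
import Summits.ResolutionOfSingularities.ResolutionOfSingularities.Theorems.FrobeniusClosingSteerBetaLegality
import Literature.AlgebraicGeometry.Resolution.LogRegularEtaleLocal
import Literature.AlgebraicGeometry.Resolution.RegularFormalFibresPolynomial
import Mathlib.RingTheory.Ideal.GoingDown
import Mathlib.RingTheory.KrullDimension.NonZeroDivisors
import Mathlib.RingTheory.KrullDimension.Field
import HarnessLib

/-!
# Crux `Steer` (stmt-ResolutionOfSingularities-16345), chain W4.1 — K-β7-hat W1 FILE 4 `…K7HatBranches`: the minimal primes of `Q₀T`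

OURS (campaign `res-hironaka`, rung L ★L-G4, slot W4.1). FILE 4 of res-L0-w41-idea-3 g12's W1 route for `K7Hat.BranchTransfer` (plan
`L/res-L0-w41-idea-3/k7w1/W1-PLAN.md` bc52383b129f540e, signatures `K7HatW1_signatures.lean` b44118b3d9553ffe §4, OFFERED TO THE POOL; taken by
res-D-pv-035 g8). The two theorems below have EXACTLY the signatures of §4 (types byte-identical up to binder layout), so idea-3's FILE 6
`branchTransfer_holds` cites them BY NAME for clause (iii) of `BranchTransfer` and for the minimality of `P₁` in clause (ii).
Replaces the role of no printed item; NOT a statement of the manuscript under review [claim: Hironaka2017, status: under-review]; AI-produced,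
weaker than expert review; counted 0.

* `minimalPrimes_map_contract` — BRANCHES. `S → T` a flat local homomorphism of Noetherian local rings with `𝔪_S T = 𝔪_T`, `Q` a prime of `S`
  with `dim S ⧸ Q = 1`. Then every minimal prime `P` of `QT` CONTRACTS to `Q` (going down for flat maps: a minimal prime of `QT` lies over `Q` — tree `Literature…under_eq_of_mem_minimalPrimes_map`)
  and has `dim T ⧸ P = 1`: `T ⧸ QT` is flat over `S ⧸ Q` with trivial closed fibre, so `dim T ⧸ QT = dim S ⧸ Q = 1`
  (`ringKrullDim_eq_of_flat_of_map_maximalIdeal_eq`, `map_maximalIdeal_quotientMap_eq`); `dim T ⧸ P ≤ dim T ⧸ QT` by the surjection; and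
  `P ≠ 𝔪_T` — otherwise, `𝔪_T` being minimal over `QT`, EVERY prime containing `QT` equals `𝔪_T` and the chain of length `1` that
  `dim T ⧸ QT = 1` provides (`ringKrullDim_quotient`, `Order.le_krullDim_iff`) collapses — so `dim T ⧸ P ≥ 1` by the chain `P < 𝔪_T`.
* `mem_minimalPrimes_of_dim_one` — MINIMALITY OF `P₁`. In a local ring, a prime `P ⊇ J` with `dim T ⧸ P = 1` is a minimal prime of `J` as soon
  as every minimal prime of `J` has `dim 1`: a minimal prime `P′ < P` of `J` would give the chain `P′ < P < 𝔪` and `dim T ⧸ P′ ≥ 2`.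
[cite: Matsumura1987, Thm. 9.5, Thm. 15.1] [folklore]
bears_on: LADDER-RESOLUTION L ★L-G4 W4.1 (crux `Steer`, β-leaf binder hβ6′ `FormalCentreDescent`, piece W1 (iii)/(ii)).
-/

noncomputable section

set_option linter.dupNamespace false
set_option autoImplicit false

open IsLocalRing

namespace Summit.ResolutionOfSingularities.ResolutionOfSingularities.Theorems.SwitchingDichotomy.K7HatBranches

open Literature.AlgebraicGeometry.Resolution
open Summit.ResolutionOfSingularities.ResolutionOfSingularities.Theorems.SwitchingDichotomy.K7HatBranchConclusion
  (two_le_ringKrullDim_quotient_of_lt')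
open Summit.ResolutionOfSingularities.ResolutionOfSingularities.Theorems.SwitchingDichotomy.BetaLegality
  (one_le_ringKrullDim_quotient_of_ne_maximalIdeal)

/-! ## Helpers -/

section Helpers

/-- If the maximal ideal of a local ring is a MINIMAL prime of `J`, then it is the only prime containing `J`, so `dim T ⧸ J < 1`: there is no
chain of length one among the primes containing `J`. [folklore] -/
theorem not_one_le_ringKrullDim_quotient_of_maximalIdeal_mem_minimalPrimes {T : Type} [CommRing T] [IsLocalRing T]
    {J : Ideal T} (h : maximalIdeal T ∈ J.minimalPrimes) : ¬ (1 : WithBot ℕ∞) ≤ ringKrullDim (T ⧸ J) := by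
  intro h1
  rw [ringKrullDim_quotient] at h1
  obtain ⟨s, hs⟩ := Order.le_krullDim_iff.1 h1
  -- every prime containing `J` equals `𝔪`
  have hall : ∀ x : PrimeSpectrum.zeroLocus (R := T) (J : Set T), x.1.asIdeal = maximalIdeal T := fun x => by
    have hJx : J ≤ x.1.asIdeal := (PrimeSpectrum.mem_zeroLocus _ _).1 x.2
    have hxm : x.1.asIdeal ≤ maximalIdeal T := IsLocalRing.le_maximalIdeal x.1.2.ne_top
    exact le_antisymm hxm (h.2 ⟨x.1.2, hJx⟩ hxm)
  have hpos : 0 < s.length := by rw [hs]; exact Nat.one_pos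
  have hstep := s.step ⟨0, hpos⟩
  have hlt : (s (Fin.castSucc ⟨0, hpos⟩)).1.asIdeal < (s (Fin.succ ⟨0, hpos⟩)).1.asIdeal := by
    have h' : (s (Fin.castSucc ⟨0, hpos⟩)).1 < (s (Fin.succ ⟨0, hpos⟩)).1 := Subtype.coe_lt_coe.mpr hstep
    rwa [← PrimeSpectrum.asIdeal_lt_asIdeal] at h'
  rw [hall, hall] at hlt
  exact lt_irrefl _ hlt

end Helpers

/-! ## FILE 4, theorem 1: the minimal primes of `QT` contract to `Q` and have coheight one -/

/-- **BRANCHES** (idea-3 `K7HatW1_signatures.lean` §4, VERBATIM signature). Flat local homomorphism of Noetherian local rings with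
`𝔪_S T = 𝔪_T` (closed fibre a field); `Q` a prime of `S` with `dim S/Q = 1`. Then every minimal prime `P` of `QT` contracts to `Q` (going down)
and has `dim T/P = 1` (`dim T/QT = dim S/Q + 0`, and `P ≠ 𝔪_T`). OURS. [cite: Matsumura1987, Thm. 9.5, Thm. 15.1] -/
theorem minimalPrimes_map_contract {S T : Type} [CommRing S] [CommRing T] [IsLocalRing S] [IsNoetherianRing S]
    [IsLocalRing T] [IsNoetherianRing T] [Algebra S T] [Module.Flat S T] [IsLocalHom (algebraMap S T)]
    (hmax : (maximalIdeal S).map (algebraMap S T) = maximalIdeal T)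
    (Q : Ideal S) [Q.IsPrime] (hQ : ringKrullDim (S ⧸ Q) = 1) :
    ∀ P ∈ (Q.map (algebraMap S T)).minimalPrimes, P.comap (algebraMap S T) = Q ∧ ringKrullDim (T ⧸ P) = 1 := by
  -- ### the quotient map `S ⧸ Q → T ⧸ QT` is flat local with trivial closed fibre, so `dim T ⧸ QT = dim S ⧸ Q = 1`
  set J : Ideal T := Q.map (algebraMap S T) with hJdef
  have hQne : Q ≠ ⊤ := Ideal.IsPrime.ne_top ‹_›
  have hJle : J ≤ maximalIdeal T := by
    rw [hJdef, ← hmax]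
    exact Ideal.map_mono (IsLocalRing.le_maximalIdeal hQne)
  have hJne : J ≠ ⊤ := fun h => (maximalIdeal.isMaximal T).ne_top (top_le_iff.mp (h ▸ hJle))
  haveI : Nontrivial (S ⧸ Q) := Ideal.Quotient.nontrivial_iff.mpr hQne
  haveI : Nontrivial (T ⧸ J) := Ideal.Quotient.nontrivial_iff.mpr hJne
  haveI : IsLocalRing (S ⧸ Q) := IsLocalRing.of_surjective' (Ideal.Quotient.mk Q) Ideal.Quotient.mk_surjective
  haveI : IsLocalRing (T ⧸ J) := IsLocalRing.of_surjective' (Ideal.Quotient.mk J) Ideal.Quotient.mk_surjective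
  haveI : Module.Flat (S ⧸ Q) (T ⧸ J) :=
    Module.Flat.of_linearEquiv (Algebra.TensorProduct.quotIdealMapEquivQuotTensor T Q).toLinearEquiv
  have hmaxJ : (maximalIdeal (S ⧸ Q)).map (algebraMap (S ⧸ Q) (T ⧸ J)) = maximalIdeal (T ⧸ J) :=
    map_maximalIdeal_quotientMap_eq hmax Q
  haveI : IsLocalHom (algebraMap (S ⧸ Q) (T ⧸ J)) := by
    refine ⟨fun a ha => ?_⟩
    by_contra hna
    have hmem : algebraMap (S ⧸ Q) (T ⧸ J) a ∈ maximalIdeal (T ⧸ J) := by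
      rw [← hmaxJ]
      exact Ideal.mem_map_of_mem _ ((IsLocalRing.mem_maximalIdeal a).mpr (mem_nonunits_iff.mpr hna))
    exact (mem_nonunits_iff.mp ((IsLocalRing.mem_maximalIdeal _).mp hmem)) ha
  have hdimJ : ringKrullDim (T ⧸ J) = 1 := by
    rw [ringKrullDim_eq_of_flat_of_map_maximalIdeal_eq (S ⧸ Q) (T ⧸ J) hmaxJ, hQ]
  -- ### each minimal prime
  intro P hP
  haveI : P.IsPrime := hP.1.1
  have hJP : J ≤ P := hP.1.2
  refine ⟨under_eq_of_mem_minimalPrimes_map Q hP, le_antisymm ?_ ?_⟩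
  · rw [← hdimJ]
    exact ringKrullDim_le_of_surjective (Ideal.Quotient.factor hJP) (Ideal.Quotient.factor_surjective hJP)
  · refine one_le_ringKrullDim_quotient_of_ne_maximalIdeal P fun hPm => ?_
    rw [hPm] at hP
    exact not_one_le_ringKrullDim_quotient_of_maximalIdeal_mem_minimalPrimes hP hdimJ.ge

/-! ## FILE 4, theorem 2: a coheight-one prime over `J` is a minimal prime of `J` when all minimal primes of `J` have coheight one -/

/-- **MINIMALITY OF `P₁`** (idea-3 §4, VERBATIM signature). In a local ring: a prime `P ⊇ J` with `dim T/P = 1` is a minimal prime of `J` as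
soon as every minimal prime of `J` has `dim = 1` (a minimal prime `P′ < P` would give `dim T/P′ ≥ 2`). OURS. [folklore] -/
theorem mem_minimalPrimes_of_dim_one {T : Type} [CommRing T] [IsLocalRing T] (J P : Ideal T) [P.IsPrime] (hJP : J ≤ P)
    (hP : ringKrullDim (T ⧸ P) = 1) (hmin : ∀ P' ∈ J.minimalPrimes, ringKrullDim (T ⧸ P') = 1) :
    P ∈ J.minimalPrimes := by
  obtain ⟨P', hP'min, hP'P⟩ := Ideal.exists_minimalPrimes_le hJP
  haveI : P'.IsPrime := hP'min.1.1
  by_cases h : P' = P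
  · exact h ▸ hP'min
  · exfalso
    have hlt : P' < P := lt_of_le_of_ne hP'P h
    have hne : P ≠ maximalIdeal T := by
      intro hPm
      have h0 : ringKrullDim (T ⧸ P) = 0 := by
        rw [hPm]
        letI := Ideal.Quotient.field (maximalIdeal T)
        exact ringKrullDim_eq_zero_of_field _
      rw [h0] at hP
      exact zero_ne_one hP
    have h2 := two_le_ringKrullDim_quotient_of_lt' hlt hne
    rw [hmin P' hP'min] at h2
    have : (2 : ℕ) ≤ 1 := by exact_mod_cast h2
    omega

end Summit.ResolutionOfSingularities.ResolutionOfSingularities.Theorems.SwitchingDichotomy.K7HatBranches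

end
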